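import Mathlib.Analysis.Calculus.DerivativeTest
import Mathlib.Analysis.Calculus.MeanValue
import Mathlib.Topology.Order.Compact
import Literature.Analysis.ODE.SoninEnvelope
import HarnessLib

/-!
# The diagonal Green kernel inside a forbidden region: a maximum principle
# (Gelfand–Dikii-type bound for a pair of complex solutions)

Topic `Literature/Analysis/ODE` (namespace `Literature.Analysis.ODE`). For the REAL equation
`y″ = q(x) y` and two COMPLEX solutions `u, v` (think: the horizon-normalised and the
infinity-normalised solutions of a radial wave equation), the diagonal of the Green kernel is
`G(x, x) = u(x)v(x)/W`, `W = u v′ − v u′` (constant). In a classically forbidden region `q > 0`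
both `|u|` and `|v|` may be exponentially large, growing in opposite directions; the content of a
Green-kernel bound is that the product `|u v|` never exceeds `|W|` by more than a polynomial factor.
This file proves the pointwise core of that statement WITHOUT any asymptotic analysis:

* `wronskian_complex_const` — `W = u v′ − v u′` is constant on `[α, β]`;
* `four_mul_mul_le_wronskian_sq_of_critical` — pure algebra at one point: if `P = |u|²|v|²` has
  `P′ = 0` and `P″ ≤ 0` there (an interior local maximum of the product of the moduli), then
  **`4q|u|²|v|² + 2F_u²|v|²/|u|² + 2F_v²|u|²/|v|² ≤ |W|²`**, where `F_u = Im(ū u′)`, `F_v = Im(v̄ v′)` are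
  the conserved fluxes; in particular `|u v / W|² ≤ 1/(4q)` at such a point (`…_of_isLocalMax` does the
  calculus: `P′ = 2Re(ūu′)|v|² + 2|u|²Re(v̄v′)`, `P″ = 2[(|u′|² + q|u|²)|v|² + 4Re(ūu′)Re(v̄v′) +
  |u|²(|v′|² + q|v|²)]`, first/second derivative tests, the latter inlined after
  `Literature.Analysis.FluidPDE.IsLocalMax.deriv_deriv_nonpos`);
* `norm_sq_mul_norm_sq_le_max` — the **maximum principle**: if `q ≥ q₀ > 0` on `(a, b)`, then for
  every `y ∈ [a, b]`,
  `|u(y)|²|v(y)|² ≤ max(|u(a)|²|v(a)|², |u(b)|²|v(b)|², |W|²/(4q₀))`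
  — the diagonal kernel in a barrier is controlled by its values at the two ends of the barrier and
  by `1/(2√q₀)` (the value `1/(2√q)` is the diagonal kernel of the constant-coefficient problem).

Mechanism (proof of the algebraic core): `ū v̄ W = |u|²(v̄ v′) − |v|²(ū u′)`, so
`|u|²|v|²|W|² ≥ (|u|² Re(v̄v′) − |v|² Re(ūu′))² = 4|v|⁴(Re ūu′)²` at a critical point of `P`, while
`P″ ≤ 0` reads `2|v|⁴(Re ūu′)² ≥ 2q|u|⁴|v|⁴ + |v|⁴(Im ūu′)² + |u|⁴(Im v̄v′)²` after inserting
`|ū u′|² = |u|²|u′|²`. Everything is proved; hypotheses are pointwise `HasDerivAt` statements.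

Used toward the cone Green-kernel bound of the near-extremal Kerr programme (stub
`stub_coneKernelNonSuperradiant`: the diagonal kernel inside the single barrier).

## References
* I. M. Gelfand, L. A. Dikii, *Asymptotic behaviour of the resolvent of Sturm–Liouville equations
  and the algebra of the Korteweg–de Vries equations*, Russian Math. Surveys 30:5 (1975) 77–113
  (the diagonal resolvent kernel `R = ψ₊ψ₋/W` and its equation `2RR″ − R′² − 4qR² = −1`).
* P. Hartman, *Ordinary Differential Equations* (SIAM Classics 38, 2002), Ch. XI §2.
-/

noncomputable section

open Set Filter Topology
open scoped ComplexConjugate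

namespace Literature.Analysis.ODE

/-! ### Constancy of the Wronskian of two complex solutions -/

/-- **`W = u v′ − v u′` is constant** for two complex solutions of `y″ = q y` on `[α, β]`.
[folklore] -/
theorem wronskian_complex_const {u u' v v' : ℝ → ℂ} {q : ℝ → ℝ} {α β : ℝ}
    (hu : ∀ x ∈ Icc α β, HasDerivAt u (u' x) x ∧ HasDerivAt u' ((q x : ℂ) * u x) x)
    (hv : ∀ x ∈ Icc α β, HasDerivAt v (v' x) x ∧ HasDerivAt v' ((q x : ℂ) * v x) x) {x : ℝ}
    (hx : x ∈ Icc α β) :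
    u x * v' x - v x * u' x = u α * v' α - v α * u' α := by
  refine constant_of_has_deriv_right_zero (f := fun y => u y * v' y - v y * u' y) ?_ ?_ x hx
  · intro y hy
    exact ((((hu y hy).1.mul (hv y hy).2).sub ((hv y hy).1.mul (hu y hy).2)).continuousAt).continuousWithinAt
  · intro y hy
    have hy' : y ∈ Icc α β := Ico_subset_Icc_self hy
    have h := ((hu y hy').1.mul (hv y hy').2).sub ((hv y hy').1.mul (hu y hy').2)
    have e : u' y * v' y + u y * ((q y : ℂ) * v y) - (v' y * u' y + v y * ((q y : ℂ) * u y)) = 0 := by ring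
    rw [e] at h
    exact h.hasDerivWithinAt

/-! ### The algebraic core at a critical maximum of `|u|²|v|²` -/

/-- `|conj(u)·w|² = |u|²|w|²` in the form `Re² + Im² = |u|²|w|²`. [folklore] -/
theorem re_sq_add_im_sq_conj_mul (u w : ℂ) :
    (conj u * w).re ^ 2 + (conj u * w).im ^ 2 = ‖u‖ ^ 2 * ‖w‖ ^ 2 := by
  have h : ‖conj u * w‖ ^ 2 = (conj u * w).re ^ 2 + (conj u * w).im ^ 2 := by
    rw [Complex.sq_norm, Complex.normSq_apply]; ring
  rw [← h, norm_mul, Complex.norm_conj, mul_pow]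

/-- `ū v̄ (u v₁ − v u₁) = |u|² (v̄ v₁) − |v|² (ū u₁)`. [folklore] -/
theorem conj_mul_conj_mul_wronskian (u u₁ v v₁ : ℂ) :
    conj u * conj v * (u * v₁ - v * u₁) =
      ((‖u‖ ^ 2 : ℝ) : ℂ) * (conj v * v₁) - ((‖v‖ ^ 2 : ℝ) : ℂ) * (conj u * u₁) := by
  have hu : ((‖u‖ ^ 2 : ℝ) : ℂ) = conj u * u := by rw [Complex.conj_mul']; push_cast; ring
  have hv : ((‖v‖ ^ 2 : ℝ) : ℂ) = conj v * v := by rw [Complex.conj_mul']; push_cast; ring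
  rw [hu, hv]; ring

/-- **Algebraic core.** Let `u, v, u₁, v₁ ∈ ℂ`, `q ∈ ℝ`, and suppose the product of the
squared moduli `P = |u|²|v|²` is critical and concave "along the equation", i.e.
`Re(ū u₁)|v|² + |u|² Re(v̄ v₁) = 0` (`P′/2 = 0`) and
`(|u₁|² + q|u|²)|v|² + 4 Re(ū u₁) Re(v̄ v₁) + |u|²(|v₁|² + q|v|²) ≤ 0` (`P″/2 ≤ 0`). Then, with
`W = u v₁ − v u₁`, `F_u = Im(ū u₁)`, `F_v = Im(v̄ v₁)`:
`4q|u|⁴|v|⁴ + 2F_u²|v|⁴ + 2F_v²|u|⁴ ≤ |u|²|v|²|W|²`. [folklore] -/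
theorem four_mul_mul_le_wronskian_sq_of_critical (u u₁ v v₁ : ℂ) (q : ℝ)
    (h1 : (conj u * u₁).re * ‖v‖ ^ 2 + ‖u‖ ^ 2 * (conj v * v₁).re = 0)
    (h2 : (‖u₁‖ ^ 2 + q * ‖u‖ ^ 2) * ‖v‖ ^ 2 + 4 * (conj u * u₁).re * (conj v * v₁).re +
      ‖u‖ ^ 2 * (‖v₁‖ ^ 2 + q * ‖v‖ ^ 2) ≤ 0) :
    4 * q * (‖u‖ ^ 2) ^ 2 * (‖v‖ ^ 2) ^ 2 + 2 * (conj u * u₁).im ^ 2 * (‖v‖ ^ 2) ^ 2 +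
        2 * (conj v * v₁).im ^ 2 * (‖u‖ ^ 2) ^ 2 ≤
      ‖u‖ ^ 2 * ‖v‖ ^ 2 * ‖u * v₁ - v * u₁‖ ^ 2 := by
  set α := conj u * u₁ with hα
  set β := conj v * v₁ with hβ
  set ρu := ‖u‖ ^ 2 with hρu
  set ρv := ‖v‖ ^ 2 with hρv
  have hρu0 : 0 ≤ ρu := sq_nonneg _
  have hρv0 : 0 ≤ ρv := sq_nonneg _
  -- `|α|² = ρu |u₁|²`, `|β|² = ρv |v₁|²`
  have hαn : α.re ^ 2 + α.im ^ 2 = ρu * ‖u₁‖ ^ 2 := re_sq_add_im_sq_conj_mul u u₁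
  have hβn : β.re ^ 2 + β.im ^ 2 = ρv * ‖v₁‖ ^ 2 := re_sq_add_im_sq_conj_mul v v₁
  -- `ρu ρv |W|² = |ρu β − ρv α|²`
  have hW : ρu * ρv * ‖u * v₁ - v * u₁‖ ^ 2 =
      (ρu * β.re - ρv * α.re) ^ 2 + (ρu * β.im - ρv * α.im) ^ 2 := by
    have e1 : ρu * ρv * ‖u * v₁ - v * u₁‖ ^ 2 = ‖conj u * conj v * (u * v₁ - v * u₁)‖ ^ 2 := by
      rw [norm_mul, norm_mul, Complex.norm_conj, Complex.norm_conj, mul_pow, mul_pow]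
    have e2 : conj u * conj v * (u * v₁ - v * u₁) = ((ρu : ℝ) : ℂ) * β - ((ρv : ℝ) : ℂ) * α :=
      conj_mul_conj_mul_wronskian u u₁ v v₁
    rw [e1, e2, Complex.sq_norm, Complex.normSq_apply, Complex.sub_re, Complex.sub_im,
      Complex.re_ofReal_mul, Complex.re_ofReal_mul, Complex.im_ofReal_mul, Complex.im_ofReal_mul]
    ring
  -- multiply `h2` by `ρu ρv ≥ 0` and insert the norm identities
  have h2' : ρu * ρv * ((‖u₁‖ ^ 2 + q * ρu) * ρv + 4 * α.re * β.re + ρu * (‖v₁‖ ^ 2 + q * ρv)) ≤ 0 :=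
    mul_nonpos_of_nonneg_of_nonpos (mul_nonneg hρu0 hρv0) h2
  -- from `h1`: `ρu β.re = −ρv α.re`
  have h1' : ρu * β.re = -(ρv * α.re) := by linarith
  rw [hW]
  nlinarith [hαn, hβn, h1', h2', sq_nonneg (ρu * β.im - ρv * α.im), sq_nonneg α.re,
    mul_nonneg hρu0 hρv0]

/-! ### Calculus: the conditions hold at an interior local maximum -/

/-- **The diagonal kernel at an interior maximum of `|u|²|v|²`.** Let `u, v` be complex solutions of
`y″ = q y` with the derivative data on an open interval `(a, b)`, and let `y ∈ (a, b)` be a local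
maximum of `P = |u|²|v|²`. Then `4q(y)|u|⁴|v|⁴ + 2F_u²|v|⁴ + 2F_v²|u|⁴ ≤ |u|²|v|²|W(y)|²` at `y`.
[folklore] -/
theorem four_mul_mul_le_wronskian_sq_of_isLocalMax {u u' v v' : ℝ → ℂ} {q : ℝ → ℝ} {a b y : ℝ}
    (hu : ∀ x ∈ Ioo a b, HasDerivAt u (u' x) x ∧ HasDerivAt u' ((q x : ℂ) * u x) x)
    (hv : ∀ x ∈ Ioo a b, HasDerivAt v (v' x) x ∧ HasDerivAt v' ((q x : ℂ) * v x) x)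
    (hy : y ∈ Ioo a b) (hmax : IsLocalMax (fun x => ‖u x‖ ^ 2 * ‖v x‖ ^ 2) y) :
    4 * q y * (‖u y‖ ^ 2) ^ 2 * (‖v y‖ ^ 2) ^ 2 + 2 * (conj (u y) * u' y).im ^ 2 * (‖v y‖ ^ 2) ^ 2 +
        2 * (conj (v y) * v' y).im ^ 2 * (‖u y‖ ^ 2) ^ 2 ≤
      ‖u y‖ ^ 2 * ‖v y‖ ^ 2 * ‖u y * v' y - v y * u' y‖ ^ 2 := by
  -- first derivatives of `ρu = |u|²`, `ρv = |v|²` and of `P`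
  set P : ℝ → ℝ := fun x => ‖u x‖ ^ 2 * ‖v x‖ ^ 2 with hP
  set P₁ : ℝ → ℝ := fun x =>
    2 * (conj (u x) * u' x).re * ‖v x‖ ^ 2 + ‖u x‖ ^ 2 * (2 * (conj (v x) * v' x).re) with hP₁
  have hd1 : ∀ x ∈ Ioo a b, HasDerivAt P (P₁ x) x := fun x hx =>
    (hasDerivAt_norm_sq_complex (hu x hx).1).mul (hasDerivAt_norm_sq_complex (hv x hx).1)
  have hd2 : ∀ x ∈ Ioo a b, HasDerivAt P₁
      ((2 * ‖u' x‖ ^ 2 + 2 * q x * ‖u x‖ ^ 2) * ‖v x‖ ^ 2 +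
          2 * (conj (u x) * u' x).re * (2 * (conj (v x) * v' x).re) +
        (2 * (conj (u x) * u' x).re * (2 * (conj (v x) * v' x).re) +
          ‖u x‖ ^ 2 * (2 * ‖v' x‖ ^ 2 + 2 * q x * ‖v x‖ ^ 2))) x := by
    intro x hx
    have h1 := (hasDerivAt_two_re_conj_mul (hu x hx).1 (hu x hx).2).mul
      (hasDerivAt_norm_sq_complex (hv x hx).1)
    have h2 := (hasDerivAt_norm_sq_complex (hu x hx).1).mul
      (hasDerivAt_two_re_conj_mul (hv x hx).1 (hv x hx).2)
    exact h1.add h2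
  -- `deriv P = P₁` near `y`, hence `deriv (deriv P) y = P₁′(y)`
  have hPd : deriv P =ᶠ[𝓝 y] P₁ := by
    filter_upwards [Ioo_mem_nhds hy.1 hy.2] with x hx using (hd1 x hx).deriv
  have hdd : deriv (deriv P) y =
      (2 * ‖u' y‖ ^ 2 + 2 * q y * ‖u y‖ ^ 2) * ‖v y‖ ^ 2 +
          2 * (conj (u y) * u' y).re * (2 * (conj (v y) * v' y).re) +
        (2 * (conj (u y) * u' y).re * (2 * (conj (v y) * v' y).re) +
          ‖u y‖ ^ 2 * (2 * ‖v' y‖ ^ 2 + 2 * q y * ‖v y‖ ^ 2)) := by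
    rw [hPd.deriv_eq]; exact (hd2 y hy).deriv
  -- first- and second-order conditions at the maximum
  have h1 : P₁ y = 0 := by
    have := hmax.deriv_eq_zero
    rwa [(hd1 y hy).deriv] at this
  -- second-derivative test, necessary form (as in `Literature.Analysis.FluidPDE.IsLocalMax.deriv_deriv_nonpos`):
  -- were `deriv (deriv P) y > 0`, `y` would also be a local minimum, `P` locally constant, `P″(y) = 0`
  have h2 : deriv (deriv P) y ≤ 0 := by
    by_contra hpos
    push Not at hpos
    have hmin : IsLocalMin P y :=
      isLocalMin_of_deriv_deriv_pos hpos hmax.deriv_eq_zero (hd1 y hy).continuousAt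
    have heq : P =ᶠ[𝓝 y] fun _ => P y := (hmax.and hmin).mono fun s hs => le_antisymm hs.1 hs.2
    have e1 : deriv P =ᶠ[𝓝 y] deriv fun _ : ℝ => P y := heq.deriv
    have e2 : deriv (deriv P) y = deriv (deriv fun _ : ℝ => P y) y := e1.deriv_eq
    rw [e2] at hpos
    simp at hpos
  rw [hdd] at h2
  refine four_mul_mul_le_wronskian_sq_of_critical (u y) (u' y) (v y) (v' y) (q y) ?_ ?_
  · simp only [hP₁] at h1
    linarith
  · linarith

/-! ### The maximum principle for the diagonal kernel in a barrier -/

/-- **Maximum principle for `|u|²|v|²` in a forbidden region.** Let `u, v` be complex solutions of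
`y″ = q y` on `[a, b]` (derivative data at every point of `[a, b]`), with `q ≥ q₀ > 0` on `(a, b)`.
Then for every `y ∈ [a, b]`:
`|u(y)|²|v(y)|² ≤ max (|u(a)|²|v(a)|²) (max (|u(b)|²|v(b)|²) (|W|²/(4q₀)))`,
where `W = u(a)v′(a) − v(a)u′(a)` is the (constant) Wronskian. [folklore] -/
theorem norm_sq_mul_norm_sq_le_max {u u' v v' : ℝ → ℂ} {q : ℝ → ℝ} {a b q₀ : ℝ}
    (hu : ∀ x ∈ Icc a b, HasDerivAt u (u' x) x ∧ HasDerivAt u' ((q x : ℂ) * u x) x)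
    (hv : ∀ x ∈ Icc a b, HasDerivAt v (v' x) x ∧ HasDerivAt v' ((q x : ℂ) * v x) x)
    (hq₀ : 0 < q₀) (hq : ∀ x ∈ Ioo a b, q₀ ≤ q x) {y : ℝ} (hy : y ∈ Icc a b) :
    ‖u y‖ ^ 2 * ‖v y‖ ^ 2 ≤
      max (‖u a‖ ^ 2 * ‖v a‖ ^ 2) (max (‖u b‖ ^ 2 * ‖v b‖ ^ 2)
        (‖u a * v' a - v a * u' a‖ ^ 2 / (4 * q₀))) := by
  have hab : a ≤ b := hy.1.trans hy.2
  set P : ℝ → ℝ := fun x => ‖u x‖ ^ 2 * ‖v x‖ ^ 2 with hP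
  -- `P` is continuous on `[a, b]`, hence attains its maximum at some `z`
  have hcont : ContinuousOn P (Icc a b) := fun x hx =>
    ((hasDerivAt_norm_sq_complex (hu x hx).1).mul
      (hasDerivAt_norm_sq_complex (hv x hx).1)).continuousAt.continuousWithinAt
  obtain ⟨z, hz, hzmax⟩ := isCompact_Icc.exists_isMaxOn (nonempty_Icc.2 hab) hcont
  have hPy : P y ≤ P z := hzmax hy
  -- three cases for the location of `z`
  rcases eq_or_lt_of_le hz.1 with hza | hza
  · -- `z = a`
    rw [← hza] at hPy
    exact hPy.trans (le_max_left _ _)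
  rcases eq_or_lt_of_le hz.2 with hzb | hzb
  · rw [hzb] at hPy
    exact hPy.trans ((le_max_left _ _).trans (le_max_right _ _))
  -- interior maximum: apply the critical-point inequality
  have hzI : z ∈ Ioo a b := ⟨hza, hzb⟩
  have hloc : IsLocalMax P z := by
    have hnhds : Icc a b ∈ 𝓝 z := Icc_mem_nhds hza hzb
    exact Filter.eventually_of_mem hnhds fun x hx => hzmax hx
  have hineq := four_mul_mul_le_wronskian_sq_of_isLocalMax
    (fun x hx => hu x (Ioo_subset_Icc_self hx)) (fun x hx => hv x (Ioo_subset_Icc_self hx)) hzI hloc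
  have hWc : u z * v' z - v z * u' z = u a * v' a - v a * u' a := wronskian_complex_const hu hv hz
  rw [hWc] at hineq
  set w2 := ‖u a * v' a - v a * u' a‖ ^ 2 with hw2
  have hqz : q₀ ≤ q z := hq z hzI
  have hPz0 : 0 ≤ P z := mul_nonneg (sq_nonneg _) (sq_nonneg _)
  -- from `4 q(z) P(z)² ≤ P(z) w2` (dropping the flux terms) deduce `P z ≤ w2/(4 q₀)`
  have hkey : 4 * q z * (P z) ^ 2 ≤ P z * w2 := by
    have hf1 : 0 ≤ 2 * (conj (u z) * u' z).im ^ 2 * (‖v z‖ ^ 2) ^ 2 := by positivity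
    have hf2 : 0 ≤ 2 * (conj (v z) * v' z).im ^ 2 * (‖u z‖ ^ 2) ^ 2 := by positivity
    have e : (P z) ^ 2 = (‖u z‖ ^ 2) ^ 2 * (‖v z‖ ^ 2) ^ 2 := by rw [hP]; ring
    rw [e]
    calc 4 * q z * ((‖u z‖ ^ 2) ^ 2 * (‖v z‖ ^ 2) ^ 2)
          = 4 * q z * (‖u z‖ ^ 2) ^ 2 * (‖v z‖ ^ 2) ^ 2 := by ring
      _ ≤ ‖u z‖ ^ 2 * ‖v z‖ ^ 2 * w2 := by linarith
      _ = P z * w2 := by rw [hP]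
  have hPz : P z ≤ w2 / (4 * q₀) := by
    rcases hPz0.lt_or_eq with hpos | hzero
    · rw [le_div_iff₀ (by positivity)]
      have : 4 * q z * P z ≤ w2 := by
        have := hkey
        nlinarith
      nlinarith [mul_le_mul_of_nonneg_left hqz (by positivity : (0:ℝ) ≤ 4 * P z)]
    · rw [← hzero]; positivity
  exact hPy.trans (hPz.trans ((le_max_right _ _).trans (le_max_right _ _)))

end Literature.Analysis.ODE

end
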